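import Summits.CriticalPhenomena.SAWScalingLimit.Theorems.SAWDevelopingMapHexTransferPinLineReduction

/-!
# The quarter-turn pin in law form: a `δℤ²` SAW limit that is SLE(8/3) modulo an unidentified
# real-linear map IS SLE(8/3)

By-product of line `pin-the-shear` (crux `HexTransfer`, stmt-CriticalPhenomena-14221), stated so that
other lines and routes can consume it in one line:

* line `dodecagonal-pivot` of the same crux: its registered stub
  `stub_squarePin : StretchRigidity → SquareSLEModL → SAWScalingLimit` is `fun _ h => …` over the
  theorem below once `SquareSLEModL` is unfolded (stretch rigidity is a theorem of the tree now,
  `stub_stretchRigidity`, item 5793);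
* route SAWBrickWallHomotopy: the GL₂⁺ (indeed `a z + b z̄`) form of the tail of its `Assembly`.

**Theorem** (`sawScalingLimit_of_squareSLE_modulo_linear`). Suppose that for ONE orientation-preserving
real-linear map `Φ z = a z + b z̄` (`‖b‖ < ‖a‖`) and a chordal family `P` of SLE(8/3) laws, the
critical `δℤ²` SAW law of every Dobrushin domain `D` (every `ℤ²` endpoint approximation) converges in
law to `Φ_* P(Φ⁻¹ D)`. Then `SAWScalingLimit`.
Proof: law form ↦ random-variable form of the image limit (`imageLimit_of_lawForm`); the exact
quarter-turn symmetry of `δℤ²` makes `Φ⁻¹ R Φ` a covariance of the SLE(8/3) family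
(`stub_conjugateRotationCovariance`, `stub_quarterTurnCovariance`); in the matrix of `Φ`
(`m₁₁ = a₁ + b₁`, `m₁₂ = b₂ - a₂`, `m₂₁ = a₂ + b₂`, `m₂₂ = a₁ - b₁`, determinant `‖a‖² - ‖b‖² > 0`)
linear pinning over stretch rigidity and the 2×2 algebra give `m₁₂ = -m₂₁`, `m₂₂ = m₁₁`, i.e.
`b = 0`; so `Φ` is the similarity `z ↦ a z` and `stub_similarityIdentification` ends.
-/

noncomputable section

namespace Summit.CriticalPhenomena.SAWScalingLimit.Cruxes.HexTransfer.PinTheShear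

open MeasureTheory Filter Topology Set
open scoped NNReal ENNReal ComplexConjugate
open Literature.Probability.RandomPlanarGeometry
open Literature.Probability.LatticeModels (Site)
open Literature.Probability (Process.preWienerMeasure)
open Summit.CriticalPhenomena.SAWScalingLimit.Theses

/-- **Law form ↦ random-variable form of an image limit.** If the `δℤ²` SAW laws converge in law (limit
variable `id`) to `Φ_* P(Φ⁻¹ D)` with `P(Φ⁻¹ D)` a chordal SLE(8/3) law, then they converge in law to
`Φ ∘ Γ` for an SLE(8/3) random curve `Γ` of `Φ⁻¹ D` on the canonical space (`integral_map` twice).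
[folklore] -/
theorem imageLimit_of_lawForm {Φ : ℂ ≃ₜ ℂ} {P : ChordalFamily}
    (hP : ∀ D : DobrushinDomain, IsSLELaw ((8 : ℝ≥0) / 3) D (P D))
    (hlim : ∀ (D : DobrushinDomain) (u v : ℝ → Site 2), SAW.IsEndpointApprox D u v →
      TendstoLaw (fun δ (γ : SAW.DomainSAW D.carrier δ (u δ) (v δ)) => γ.curve)
        (fun δ => SAW.law D.carrier δ (u δ) (v δ)) id
        ((P (D.map Φ.symm)).map (CurveClass.map (Φ : C(ℂ, ℂ))))) :
    ∀ (D : DobrushinDomain) (a b : ℝ → Site 2), SAW.IsEndpointApprox D a b →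
      ∃ Γ : (ℝ≥0 → ℝ) → CurveClass ℂ, IsSLECurve ((8 : ℝ≥0) / 3) (D.map Φ.symm) Γ ∧
        TendstoLaw (fun δ (γ : SAW.DomainSAW D.carrier δ (a δ) (b δ)) => γ.curve)
          (fun δ => SAW.law D.carrier δ (a δ) (b δ))
          (fun ω => CurveClass.map (Φ : C(ℂ, ℂ)) (Γ ω)) Process.preWienerMeasure := by
  intro D a b hab
  obtain ⟨Γ, hΓ, hPΓ⟩ := hP (D.map Φ.symm)
  refine ⟨Γ, hΓ, fun f => ?_⟩
  have hval : ∫ x, f (id x) ∂((Process.preWienerMeasure.map Γ).map (CurveClass.map (Φ : C(ℂ, ℂ)))) =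
      ∫ ω, f (CurveClass.map (Φ : C(ℂ, ℂ)) (Γ ω)) ∂Process.preWienerMeasure := by
    simp only [id]
    rw [integral_map (CurveClass.measurable_map _).aemeasurable f.continuous.aestronglyMeasurable]
    exact integral_map hΓ.aemeasurable
      ((f.continuous.comp (CurveClass.continuous_map (Φ : C(ℂ, ℂ)))).aestronglyMeasurable)
  have h := hlim D a b hab f
  rw [hPΓ, hval] at h
  exact h

/-- The real matrix of `z ↦ a z + b z̄`. [folklore] -/
theorem mul_add_mul_conj_eq_linear (a b z : ℂ) :
    a * z + b * conj z =
      (((a.re + b.re) * z.re + (b.im - a.im) * z.im : ℝ) : ℂ) +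
        (((a.im + b.im) * z.re + (a.re - b.re) * z.im : ℝ) : ℂ) * Complex.I := by
  apply Complex.ext
  · simp only [Complex.add_re, Complex.mul_re, Complex.conj_re, Complex.conj_im, Complex.ofReal_re,
      Complex.ofReal_im, Complex.I_re, Complex.I_im]
    ring
  · simp only [Complex.add_im, Complex.mul_im, Complex.conj_re, Complex.conj_im, Complex.ofReal_re,
      Complex.ofReal_im, Complex.I_re, Complex.I_im]
    ring

/-- The determinant of `z ↦ a z + b z̄` is `‖a‖² - ‖b‖²`. [folklore] -/
theorem det_mul_add_mul_conj (a b : ℂ) :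
    (a.re + b.re) * (a.re - b.re) - (b.im - a.im) * (a.im + b.im) = ‖a‖ ^ 2 - ‖b‖ ^ 2 := by
  rw [Complex.sq_norm, Complex.sq_norm, Complex.normSq_apply, Complex.normSq_apply]
  ring

/-- **A `δℤ²` SAW scaling limit which is SLE(8/3) modulo an unidentified orientation-preserving
real-linear map is SLE(8/3)** (the quarter-turn pin in law form; see the module docstring).
[folklore] -/
theorem sawScalingLimit_of_squareSLE_modulo_linear :
    (∃ (a b : ℂ) (Φ : ℂ ≃ₜ ℂ), ‖b‖ < ‖a‖ ∧ (∀ z : ℂ, Φ z = a * z + b * conj z) ∧ ∃ P : ChordalFamily, (∀ D : DobrushinDomain, IsSLELaw ((8 : ℝ≥0) / 3) D (P D)) ∧ ∀ (D : DobrushinDomain) (u v : ℝ → Site 2), SAW.IsEndpointApprox D u v → TendstoLaw (fun δ (γ : SAW.DomainSAW D.carrier δ (u δ) (v δ)) => γ.curve) (fun δ => SAW.law D.carrier δ (u δ) (v δ)) id ((P (D.map Φ.symm)).map (CurveClass.map (Φ : C(ℂ, ℂ))))) → _root_.SAWScalingLimit := by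
  intro h
  obtain ⟨a, b, Φ, hba, hΦ, P, hP, hlim⟩ := h
  -- the matrix of `Φ` and its determinant
  set m₁₁ : ℝ := a.re + b.re with hm₁₁
  set m₁₂ : ℝ := b.im - a.im with hm₁₂
  set m₂₁ : ℝ := a.im + b.im with hm₂₁
  set m₂₂ : ℝ := a.re - b.re with hm₂₂
  have hdet : 0 < m₁₁ * m₂₂ - m₁₂ * m₂₁ := by
    rw [hm₁₁, hm₁₂, hm₂₁, hm₂₂, det_mul_add_mul_conj, sub_pos]
    exact pow_lt_pow_left₀ hba (norm_nonneg _) two_ne_zero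
  -- replace `Φ` by the linear homeomorphism `Φ₀` of that matrix (same map, with an inverse formula)
  obtain ⟨Φ₀, hΦ₀, hΦ₀'⟩ := exists_linear_homeomorph hdet.ne'
  have hΦeq : Φ = Φ₀ := by
    ext1 z
    rw [hΦ, hΦ₀, mul_add_mul_conj_eq_linear]
  rw [hΦeq] at hlim
  -- the image limit (random-variable form) and the conjugate-rotation covariance
  have hIL := imageLimit_of_lawForm hP hlim
  have hcov := stub_conjugateRotationCovariance Φ₀ hIL stub_quarterTurnCovariance
  have hψdet : 0 < (-(m₁₁ * m₁₂ + m₂₁ * m₂₂) / (m₁₁ * m₂₂ - m₁₂ * m₂₁)) *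
        ((m₁₁ * m₁₂ + m₂₁ * m₂₂) / (m₁₁ * m₂₂ - m₁₂ * m₂₁)) -
      (-(m₁₂ ^ 2 + m₂₂ ^ 2) / (m₁₁ * m₂₂ - m₁₂ * m₂₁)) *
        ((m₁₁ ^ 2 + m₂₁ ^ 2) / (m₁₁ * m₂₂ - m₁₂ * m₂₁)) := by
    rw [conjRot_det hdet.ne']
    exact one_pos
  have hpin := stub_linearPinning stub_stretchRigidity _ _ _ _ hψdet _
    (conjRot_formula_of hΦ₀ hΦ₀') hcov
  obtain ⟨h12, h22⟩ := entries_of_conj_pinned hdet hpin.1 hpin.2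
  -- hence `b = 0` and `Φ₀` is the similarity `z ↦ a z`
  have hb1 : b.re = 0 := by
    rw [hm₂₂, hm₁₁] at h22
    linarith
  have hb2 : b.im = 0 := by
    rw [hm₁₂, hm₂₁] at h12
    linarith
  have ha : a ≠ 0 := by
    rintro rfl
    have h0 : ‖b‖ < 0 := by simpa using hba
    linarith [norm_nonneg b]
  have hΦsim : Φ₀ = similarity a ha 0 := by
    ext1 z
    rw [hΦ₀, similarity_apply, add_zero]
    apply Complex.ext
    · simp [hm₁₁, hm₁₂, hb1, hb2]
      ring
    · simp [hm₂₁, hm₂₂, hb1, hb2]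
      ring
  rw [hΦsim] at hIL
  exact stub_similarityIdentification a ha hIL

end Summit.CriticalPhenomena.SAWScalingLimit.Cruxes.HexTransfer.PinTheShear

end
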